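import Summits.AnomalousDissipation.AnomalousDissipation.Theorems.EnsembleRigidityGPStatisticalRigidityWeakDuality2
import HarnessLib

/-!
# Stub `stub_tameWeakDuality` of line `Sketch` (crux stmt-AnomalousDissipation-17938, `EnsembleRigidity.GPTameDefectFloor`) — weak duality for one cylindrical certificate at the level `(E, G₁)`

The level-wise twin of `GPStatisticalRigidity.stub_weakDuality2`. ONE cylindrical certificate
`(Ψ, a, b, C, Λ)` of the Farkas-dual shape at the energy/enstrophy level `(E, G₁)`,

* cost `‖∇Ψ'(v)‖² ≤ C² (1 + ‖∇v‖²)` on `H`,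
* pointwise forced-Euler Lyapunov inequality `a − b|v|² − Λ⁻¹(1 + ‖∇v‖²) ≤ ⟨f − B(v,v), Ψ'(v)⟩`
  at every finite-enstrophy `v ∈ H`,
* gap `Λ⁻¹ (1 + max(G₁, 0)) < a − b E` with `b ≥ 0`, `C, Λ > 0`,

gives a radius `r > 0` such that no probability measure `μ` on `H` with integrable energy
`∫|v|² dμ ≤ E` and mean enstrophy `∫‖∇v‖² dμ ≤ G₁` has Φ-uniform cylindrical forced-Euler defect
`≤ r`.

## Proof

Put `M := max(G₁, 0)`, `g := a − bE − Λ⁻¹(1 + M) > 0` and `r := g / (2 C √(1 + M))`. For such a `μ`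
the mean enstrophy `G := (∫‖∇v‖² dμ).toReal` satisfies `0 ≤ G ≤ M`, and integrating the pointwise
inequality (`GPStatisticalRigidity.weakDuality2_integrate`) gives
`a − b ∫|v|² dμ − Λ⁻¹(1 + G) ≤ r C √(1 + G)`. Monotonicity in `∫|v|² ≤ E` (`b ≥ 0`) and in `G ≤ M`
(`Λ⁻¹ > 0`, `√` monotone) turns this into `g ≤ r C √(1 + M) = g/2`, contradicting `g > 0`.

## References

* C. Foias, O. Manley, R. Rosa, R. Temam, *Navier–Stokes Equations and Turbulence* (CUP 2001),
  Ch. IV §1.2.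
* R. Rosa, R. Temam, arXiv:2010.06730 (auxiliary functionals / minimax for statistical solutions).
-/

-- `Summit.<Summit>.<Problem>` is the tree's mandated summit-side namespace (CONVENTIONS §2); single-conjunct summit, duplicate deliberate.
set_option linter.dupNamespace false

noncomputable section

namespace Summit.AnomalousDissipation.AnomalousDissipation.Theorems.EnsembleRigidity.GPTameDefectFloor

open MeasureTheory Filter Topology UnitAddTorus
open scoped InnerProductSpace RealInnerProductSpace ENNReal NNReal
open Literature.Analysis.FunctionSpaces Literature.Analysis.FluidPDE
open Summit.AnomalousDissipation.AnomalousDissipation.Theorems.EnsembleRigidity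

/-- Local notation: real vector fields on `T³`. -/
local notation "Vec3" => (UnitAddTorus (Fin 3)) → (EuclideanSpace ℝ (Fin 3))
/-- Local notation: `L²(T³; ℝ³)`. -/
local notation "L2" => (Lp (EuclideanSpace ℝ (Fin 3)) 2 (volume : Measure (UnitAddTorus (Fin 3))))
/-- Local notation: the energy space `H`. -/
local notation "H3" => (Torus.energySpace (Fin 3))

/-- **Arithmetic endgame of the level-wise weak duality.** With `g := a − bE − Λ⁻¹(1+M) > 0`,
`b ≥ 0`, `Λ⁻¹ ≥ 0`, `C > 0`, `0 ≤ M`, an energy `En ≤ E`, an enstrophy `G ≤ M` and the integrated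
certificate inequality `a − b En − Λ⁻¹(1+G) ≤ r C √(1+G)` at the radius `r = g / (2 C √(1+M))`,
one gets `g ≤ g/2`, i.e. `False`. [folklore] -/
theorem weakDual_arith {a b C Λi E En G M : ℝ} (hb : 0 ≤ b) (hC : 0 < C) (hΛi : 0 ≤ Λi)
    (hM : 0 ≤ M) (hgap : Λi * (1 + M) < a - b * E) (hEn : En ≤ E) (hGM : G ≤ M)
    (hcore : a - b * En - Λi * (1 + G) ≤
      (a - b * E - Λi * (1 + M)) / (2 * C * Real.sqrt (1 + M)) * (C * Real.sqrt (1 + G))) :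
    False := by
  have hsM : 0 < Real.sqrt (1 + M) := Real.sqrt_pos.2 (by linarith)
  have hsq : Real.sqrt (1 + G) ≤ Real.sqrt (1 + M) := Real.sqrt_le_sqrt (by linarith)
  have hbE : b * En ≤ b * E := mul_le_mul_of_nonneg_left hEn hb
  have hΛG : Λi * (1 + G) ≤ Λi * (1 + M) := mul_le_mul_of_nonneg_left (by linarith) hΛi
  have hr : (a - b * E - Λi * (1 + M)) / (2 * C * Real.sqrt (1 + M)) * (C * Real.sqrt (1 + M)) =
      (a - b * E - Λi * (1 + M)) / 2 := by
    field_simp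
  have hrpos : 0 ≤ (a - b * E - Λi * (1 + M)) / (2 * C * Real.sqrt (1 + M)) :=
    div_nonneg (by linarith) (by positivity)
  have h5 : (a - b * E - Λi * (1 + M)) / (2 * C * Real.sqrt (1 + M)) * (C * Real.sqrt (1 + G)) ≤
      (a - b * E - Λi * (1 + M)) / (2 * C * Real.sqrt (1 + M)) * (C * Real.sqrt (1 + M)) :=
    mul_le_mul_of_nonneg_left (mul_le_mul_of_nonneg_left hsq hC.le) hrpos
  rw [hr] at h5
  linarith

/-- **Stub `stub_tameWeakDuality`** — WEAK DUALITY FOR ONE CYLINDRICAL CERTIFICATE AT THE LEVEL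
`(E, G₁)`. A cylindrical certificate `(Ψ, a, b, C, Λ)` of the Farkas-dual shape (cost
`‖∇Ψ'(v)‖² ≤ C²(1 + ‖∇v‖²)`, pointwise inequality `a − b|v|² − Λ⁻¹(1 + ‖∇v‖²) ≤ ⟨f − B(v,v), Ψ'(v)⟩`
at finite enstrophy, gap `Λ⁻¹(1 + max(G₁,0)) < a − bE`) yields `r > 0` such that no probability
measure on `H` with integrable energy `≤ E` and mean enstrophy `≤ G₁` has Φ-uniform cylindrical
forced-Euler defect `≤ r`: integrate (`GPStatisticalRigidity.weakDuality2_integrate`) and take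
`r = g / (2C√(1 + max(G₁,0)))`, `g` the gap. [folklore] -/
theorem stub_tameWeakDuality : ∀ (f : Vec3) (E G₁ : ℝ), (∃ (Ψ : Torus.CylindricalTest (Fin 3)) (a b C Λ : ℝ), 0 ≤ b ∧ 0 < C ∧ 0 < Λ ∧ Λ⁻¹ * (1 + max G₁ 0) < a - b * E ∧ (∀ v : H3, Torus.gradNormSq (Ψ.grad v) ≤ C ^ 2 * (1 + (Torus.eGradNormSq ((v : L2) : Vec3)).toReal)) ∧ (∀ v : H3, Torus.eGradNormSq ((v : L2) : Vec3) ≠ ⊤ → a - b * ‖v‖ ^ 2 - Λ⁻¹ * (1 + (Torus.eGradNormSq ((v : L2) : Vec3)).toReal) ≤ Torus.nsGeneratorPairing 0 f v (Ψ.grad v))) → ∃ r : ℝ, 0 < r ∧ ∀ μ : MeasureTheory.Measure (Literature.Analysis.FunctionSpaces.Torus.energySpace (Fin 3)), MeasureTheory.IsProbabilityMeasure μ → MeasureTheory.Integrable (fun v : Literature.Analysis.FunctionSpaces.Torus.energySpace (Fin 3) => ‖v‖ ^ 2) μ → Literature.Analysis.FluidPDE.Torus.ensembleEnergy μ ≤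 E → Literature.Analysis.FluidPDE.Torus.ensembleEnstrophy μ ≤ ENNReal.ofReal G₁ → ¬ (∀ Φ : Literature.Analysis.FluidPDE.Torus.CylindricalTest (Fin 3), MeasureTheory.Integrable (fun v : Literature.Analysis.FunctionSpaces.Torus.energySpace (Fin 3) => Literature.Analysis.FluidPDE.Torus.nsGeneratorPairing 0 f v (Φ.grad v)) μ ∧ |∫ v, Literature.Analysis.FluidPDE.Torus.nsGeneratorPairing 0 f v (Φ.grad v) ∂μ| ≤ r * Real.sqrt (∫ v, Literature.Analysis.FunctionSpaces.Torus.gradNormSq (Φ.grad v) ∂μ)) := by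
  intro f E G₁ ⟨Ψ, a, b, C, Λ, hb, hC, hΛ, hgap, hcost, hcert⟩
  have hM : 0 ≤ max G₁ 0 := le_max_right _ _
  have hΛi : 0 ≤ Λ⁻¹ := inv_nonneg.2 hΛ.le
  have hsM : 0 < Real.sqrt (1 + max G₁ 0) := Real.sqrt_pos.2 (by linarith)
  have hr : 0 < (a - b * E - Λ⁻¹ * (1 + max G₁ 0)) / (2 * C * Real.sqrt (1 + max G₁ 0)) :=
    div_pos (by linarith) (by positivity)
  refine ⟨(a - b * E - Λ⁻¹ * (1 + max G₁ 0)) / (2 * C * Real.sqrt (1 + max G₁ 0)), hr, ?_⟩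
  intro μ hμ hint hE hG hdef
  have hGfin : Torus.ensembleEnstrophy μ < ⊤ := hG.trans_lt ENNReal.ofReal_lt_top
  obtain ⟨hdefI, hdefΨ⟩ := hdef Ψ
  have hcore :=
    GPStatisticalRigidity.weakDuality2_integrate f μ hint hGfin Ψ hC hr.le hcost hcert hdefI hdefΨ
  have hGM : (Torus.ensembleEnstrophy μ).toReal ≤ max G₁ 0 := by
    have h := ENNReal.toReal_mono ENNReal.ofReal_ne_top hG
    rwa [ENNReal.toReal_ofReal'] at h
  exact weakDual_arith hb hC hΛi hM hgap hE hGM hcore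

end Summit.AnomalousDissipation.AnomalousDissipation.Theorems.EnsembleRigidity.GPTameDefectFloor

end
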